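import Summits.Ventures.LatticeQCDFlow.Exactness.IMHCoupledEstimatorBernstein
import Summits.Ventures.LatticeQCDFlow.Exactness.IMHEveryStartObservableRateUnboundedWeights
import HarnessLib

/-!
# The Bernstein error bar for the coupled flow-MCMC estimator WITHOUT A WEIGHT BOUND: for every positive normalised weight,
# `P(|H̄_R − π f| ≥ ε + bias_k) ≤ 2·exp(−Rε²/(2(σ² + (c − a)ε/3))) + R·P(X_k ≠ X′_k)`, with `P(X_k ≠ X′_k)` and `bias_k` explicit in
# `c₁ = E_q[min(1, w)]` and the weight tails `q{w > M}`, `π{w > M}`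

HONEST FRAMING: exact (Metropolis-corrected) sampling algorithms for lattice gauge theory;
figures of merit are autocorrelation/cost numbers at stated couplings and volumes; no
continuum-physics claim.

Venture `LatticeQCDFlow` (cell pub-lqcd), topic `Exactness`; FANOUT row 30 (lean-1, GEN-40).  NEW WORK of the cell, general
(standard Borel) state space, EVERY proposal law `q`, EVERY positive normalised weight `w = dπ/dq` — no bound on `w`, no moment
condition.  GEN-40's `Exactness/IMHCoupledEstimatorBernstein` proved the Bernstein bar of the averaged coupled estimator
`H̄_R = R⁻¹Σ_{j<R} H_{k,N}(Z_j)` under a BOUNDED weight (`w ≤ w(x₀)`: the event that a replica still carries a correction after the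
burn-in costs `R·r^k·p₀`, `r = 1 − 1/w(x₀)`).  Here the weight bound is removed:

* §1 **`crnLag_correction_ne_zero_le_offDiagonal`** — on pair-path space `P(Σ_{n<N} D_{k+n} ≠ 0) ≤ (μ̂₀K̂^k)(Δᶜ) = P(X_k ≠ X′_k)` for
  EVERY weight (merged runs stay merged; no rate needed); **`iterate_bind_crnPair_offDiagonal_le_rate_anyCoupling`** — from every initial
  coupling `(μ̂₀K̂^k)(Δᶜ) ≤ ∫_{Δᶜ} (1 − c₁/max(1, w(p.1), w(p.2)))^k dμ̂₀` (`c₁ = E_q[min(1, w)]`; the exact atoms law of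
  `IMHCommonRandomNumbersMeetingTimeAnyCouplingAtoms` and `1/A ≤ max(1, w)/c₁`); **`iterate_bind_crnPair_offDiagonal_le_tail_anyCoupling`** —
  `(μ̂₀K̂^k)(Δᶜ) ≤ μ̂₀(Δᶜ ∩ {max(w(p.1), w(p.2)) > M}) + (1 − c₁/max(1, M))^k·μ̂₀(Δᶜ)` for every level `M`.
* §2 **`crnLag_replicas_burnIn_bernstein_abs_everyWeight`** — for `R` independent coupled pairs from ANY initial coupling `ν̂`, every window
  `N`, `σ² ≥ Var_{ν̂₂K^k} f > 0`, `ε ≥ 0`, `R ≥ 1`: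
  `P(|H̄_R − (ν̂₂K^k) f| ≥ ε) ≤ 2·exp(−Rε²/(2(σ² + (c − a)ε/3))) + R·(ν̂K̂^k)(Δᶜ)` — NO HYPOTHESIS ON THE WEIGHT AT ALL.
* §3 the practical start (production run at `x`, leading run one update ahead, `ν̂_x = K(x, ·)∘(y ↦ (y, x))⁻¹`):
  **`detLag_offDiagonal_tail_le`** — `ν̂_x(Δᶜ ∩ {max(w(p.1), w(p.2)) > M}) ≤ q{w > M}` when `w(x) ≤ M` (the moved mass lies below the
  model); **`iterate_bind_crnPair_offDiagonal_detLag_le_tail`** — `P(X_k ≠ X′_k) ≤ q{w > M} + (1 − c₁/max(1, M))^k` when `w(x) ≤ M`;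
  **`crnLag_replicas_burnIn_bernstein_abs_target_everyWeight`** — ABOUT `π f` ITSELF, for `w(x) ≤ M`:
  `P(|H̄_R − π f| ≥ ε + (c − a)·(π{w > M} + (1 − c₁/max(1, M))^k)) ≤ 2·exp(−Rε²/(2(σ² + (c − a)ε/3))) + R·(q{w > M} + (1 − c₁/max(1, M))^k)`
  (the bias allowance is GEN-40's every-start observable rate `imh_everyStart_integral_sub_abs_le_tail`).
* §4 **`crnLag_replicas_bernstein_budget_everyWeight`** — the recipe: `(c − a)(π{w > M} + ρ^k) ≤ ε`, `2(σ² + (c − a)ε/3)·log(4/δ) ≤ Rε²` and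
  `R·(q{w > M} + ρ^k) ≤ δ/2` (`ρ = 1 − c₁/max(1, M)`) ⇒ `P(|H̄_R − π f| ≥ 2ε) ≤ δ` for every window `N`.
Reading (gauge files): for `R` independent coupled pairs of two exact gauge samplers on one stream of random numbers started from a
configuration `x` with `w(x) ≤ M`, after `k` discarded updates the averaged burn-in-free estimate obeys the Bernstein bar of `R` independent
measurements up to `R·(q{w > M} + (1 − c₁/max(1, M))^k)` and a bias allowance `(c − a)(π{w > M} + (1 − c₁/max(1, M))^k)` — for EVERY flow,
however heavy the tails of its weight; `c₁ ≥ ā` (the printed acceptance) and `q{w > M}` are read off the proposal stream.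
NOT CLAIMED: `σ²` in terms of `Var_π f` (see the sequel); anything for unbounded `f`.  No `sorry`, no new definitions, nothing cited as a fact.
-/

noncomputable section

namespace Summit.Ventures.LatticeQCDFlow.Exactness

open MeasureTheory ProbabilityTheory Function Finset Filter
open scoped _root_.ENNReal unitInterval Topology
open Summit.Ventures.LatticeQCDFlow.Scoring

variable {Ω : Type*} [MeasurableSpace Ω] {q : Measure Ω} [IsProbabilityMeasure q] {w : Ω → ℝ}

/-! ## §1 Corrections vanish once merged; the disagreement probability from every initial coupling -/

/-- **`P(Σ_{n<N} D_{k+n} ≠ 0) ≤ P(X_k ≠ X′_k)`** on pair-path space, for EVERY positive weight: merged runs stay merged, so a non-zero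
correction on the window `[k, k + N)` forces the runs to differ at time `k`. [ours] -/
theorem crnLag_correction_ne_zero_le_offDiagonal [MeasurableEq Ω] (hw : Measurable w) (hw0 : ∀ y, 0 < w y)
    (Khat : Kernel (Ω × Ω) (Ω × Ω)) [IsMarkovKernel Khat]
    (hK : ∀ z : Ω × Ω, Khat z = (q.prod (volume : Measure unitInterval)).map (fun p : Ω × unitInterval =>
      ((if (p.2 : ℝ) * w z.1 ≤ w p.1 then p.1 else z.1), (if (p.2 : ℝ) * w z.2 ≤ w p.1 then p.1 else z.2))))
    (μ₀ : Measure (Ω × Ω)) [IsProbabilityMeasure μ₀] (f : Ω → ℝ) (k N : ℕ) :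
    (Kernel.trajMeasure (X := fun _ : ℕ => Ω × Ω) μ₀
          (fun n : ℕ => Khat.comap (fun h : (i : ↥(Finset.Iic n)) → Ω × Ω => h ⟨n, Finset.mem_Iic.2 le_rfl⟩)
            (measurable_pi_apply _))).real
        {z | ∑ n ∈ Finset.range N, (f ((z (k + n)).1) - f ((z (k + n)).2)) ≠ 0} ≤
      ((fun m : Measure (Ω × Ω) => m.bind Khat)^[k] μ₀).real (Set.diagonal Ω)ᶜ := by
  set P := Kernel.trajMeasure (X := fun _ : ℕ => Ω × Ω) μ₀
      (fun n : ℕ => Khat.comap (fun h : (i : ↥(Finset.Iic n)) → Ω × Ω => h ⟨n, Finset.mem_Iic.2 le_rfl⟩)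
        (measurable_pi_apply _)) with hP
  have hsub : P {z | ∑ n ∈ Finset.range N, (f ((z (k + n)).1) - f ((z (k + n)).2)) ≠ 0} ≤ P {z | z k ∉ Set.diagonal Ω} := by
    refine measure_mono_ae ?_
    filter_upwards [crn_chain_ae_merged_stay hw hw0 Khat hK μ₀] with z hz
    intro hne hzk
    refine hne (sum_eq_zero fun n _ => ?_)
    have hmem : z (k + n) ∈ Set.diagonal Ω := hz k (k + n) (Nat.le_add_right k n) hzk
    rw [Set.mem_diagonal_iff.1 hmem, sub_self]
  calc P.real {z | ∑ n ∈ Finset.range N, (f ((z (k + n)).1) - f ((z (k + n)).2)) ≠ 0}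
      ≤ P.real {z | z k ∉ Set.diagonal Ω} := by
        simp only [measureReal_def]; exact ENNReal.toReal_mono (measure_ne_top _ _) hsub
    _ = ((fun m : Measure (Ω × Ω) => m.bind Khat)^[k] μ₀).real (Set.diagonal Ω)ᶜ := by
        rw [hP]; exact crn_chain_offDiagonal_real_eq Khat μ₀ k

/-- **THE DISAGREEMENT PROBABILITY FROM EVERY INITIAL COUPLING, EVERY WEIGHT**: standard Borel `Ω`;
`(μ̂₀K̂^k)(Δᶜ) ≤ ∫_{Δᶜ} (1 − c₁/max(1, w(p.1), w(p.2)))^k dμ̂₀`, `c₁ = E_q[min(1, w)]` (`ℝ≥0∞`). [ours] -/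
theorem iterate_bind_crnPair_offDiagonal_le_rate_anyCoupling [StandardBorelSpace Ω] [Nonempty Ω] [MeasurableSingletonClass Ω]
    [MeasurableEq Ω] (hw : Measurable w) (hw0 : ∀ y, 0 < w y) (Khat : Kernel (Ω × Ω) (Ω × Ω)) [IsMarkovKernel Khat]
    (hK : ∀ z : Ω × Ω, Khat z = (q.prod (volume : Measure unitInterval)).map (fun p : Ω × unitInterval =>
      ((if (p.2 : ℝ) * w z.1 ≤ w p.1 then p.1 else z.1), (if (p.2 : ℝ) * w z.2 ≤ w p.1 then p.1 else z.2))))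
    (k : ℕ) (μ₀ : Measure (Ω × Ω)) [IsFiniteMeasure μ₀] :
    ((fun m : Measure (Ω × Ω) => m.bind Khat)^[k] μ₀) (Set.diagonal Ω)ᶜ ≤
      ∫⁻ p in (Set.diagonal Ω)ᶜ, (1 - (∫⁻ y, ENNReal.ofReal (min 1 (w y)) ∂q) /
        ENNReal.ofReal (max 1 (max (w p.1) (w p.2)))) ^ k ∂μ₀ := by
  set c := ∫⁻ y, ENNReal.ofReal (min 1 (w y)) ∂q with hc
  set G : Ω × Ω → ℝ≥0∞ := fun p => (1 - c / ENNReal.ofReal (max 1 (max (w p.1) (w p.2)))) ^ k with hG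
  have hD : MeasurableSet (Set.diagonal Ω) := measurableSet_diagonal
  have hOm : MeasurableSet {p : Ω × Ω | w p.2 ≤ w p.1} := measurableSet_le (hw.comp measurable_snd) (hw.comp measurable_fst)
  have hmono : ∀ (z : Ω) (m : ℝ), w z ≤ m →
      (1 - imhAcceptMass q w z) ^ k ≤ (1 - c / ENNReal.ofReal (max 1 m)) ^ k := fun z m hzm =>
    (one_sub_imhAcceptMass_pow_le hw0 z k).trans
      (pow_le_pow_left' (tsub_le_tsub_left (ENNReal.div_le_div_left
        (ENNReal.ofReal_le_ofReal (max_le_max le_rfl hzm)) _) 1) k)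
  have h1 : ∫⁻ p in {p : Ω × Ω | w p.2 ≤ w p.1} ∩ (Set.diagonal Ω)ᶜ, (1 - imhAcceptMass q w p.1) ^ k ∂μ₀ ≤
      ∫⁻ p in {p : Ω × Ω | w p.2 ≤ w p.1} ∩ (Set.diagonal Ω)ᶜ, G p ∂μ₀ :=
    lintegral_mono fun p => hmono p.1 _ (le_max_left _ _)
  have h2 : ∫⁻ p in {p : Ω × Ω | w p.2 ≤ w p.1}ᶜ ∩ (Set.diagonal Ω)ᶜ, (1 - imhAcceptMass q w p.2) ^ k ∂μ₀ ≤
      ∫⁻ p in {p : Ω × Ω | w p.2 ≤ w p.1}ᶜ ∩ (Set.diagonal Ω)ᶜ, G p ∂μ₀ :=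
    lintegral_mono fun p => hmono p.2 _ (le_max_right _ _)
  have hunion : {p : Ω × Ω | w p.2 ≤ w p.1} ∩ (Set.diagonal Ω)ᶜ ∪ {p : Ω × Ω | w p.2 ≤ w p.1}ᶜ ∩ (Set.diagonal Ω)ᶜ =
      (Set.diagonal Ω)ᶜ := by
    rw [← Set.union_inter_distrib_right, Set.union_compl_self, Set.univ_inter]
  have hdisj : Disjoint ({p : Ω × Ω | w p.2 ≤ w p.1} ∩ (Set.diagonal Ω)ᶜ) ({p : Ω × Ω | w p.2 ≤ w p.1}ᶜ ∩ (Set.diagonal Ω)ᶜ) :=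
    (disjoint_compl_right.inter_left _).inter_right _
  rw [iterate_bind_crnPair_offDiagonal_eq_anyCoupling_atoms hw hw0 Khat hK k μ₀]
  calc ∫⁻ p in {p : Ω × Ω | w p.2 ≤ w p.1} ∩ (Set.diagonal Ω)ᶜ, (1 - imhAcceptMass q w p.1) ^ k ∂μ₀ +
        ∫⁻ p in {p : Ω × Ω | w p.2 ≤ w p.1}ᶜ ∩ (Set.diagonal Ω)ᶜ, (1 - imhAcceptMass q w p.2) ^ k ∂μ₀
      ≤ ∫⁻ p in {p : Ω × Ω | w p.2 ≤ w p.1} ∩ (Set.diagonal Ω)ᶜ, G p ∂μ₀ +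
          ∫⁻ p in {p : Ω × Ω | w p.2 ≤ w p.1}ᶜ ∩ (Set.diagonal Ω)ᶜ, G p ∂μ₀ := add_le_add h1 h2
    _ = ∫⁻ p in (Set.diagonal Ω)ᶜ, G p ∂μ₀ := by
        rw [← lintegral_union (hOm.compl.inter hD.compl) hdisj, hunion]

/-- **THE TAIL TRADE-OFF FROM EVERY INITIAL COUPLING**: for every level `M`,
`(μ̂₀K̂^k)(Δᶜ) ≤ μ̂₀(Δᶜ ∩ {M < max(w(p.1), w(p.2))}) + (1 − c₁/max(1, M))^k·μ̂₀(Δᶜ)`. [ours] -/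
theorem iterate_bind_crnPair_offDiagonal_le_tail_anyCoupling [StandardBorelSpace Ω] [Nonempty Ω] [MeasurableSingletonClass Ω]
    [MeasurableEq Ω] (hw : Measurable w) (hw0 : ∀ y, 0 < w y) (Khat : Kernel (Ω × Ω) (Ω × Ω)) [IsMarkovKernel Khat]
    (hK : ∀ z : Ω × Ω, Khat z = (q.prod (volume : Measure unitInterval)).map (fun p : Ω × unitInterval =>
      ((if (p.2 : ℝ) * w z.1 ≤ w p.1 then p.1 else z.1), (if (p.2 : ℝ) * w z.2 ≤ w p.1 then p.1 else z.2))))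
    (k : ℕ) (μ₀ : Measure (Ω × Ω)) [IsFiniteMeasure μ₀] (M : ℝ) :
    ((fun m : Measure (Ω × Ω) => m.bind Khat)^[k] μ₀) (Set.diagonal Ω)ᶜ ≤
      μ₀ ((Set.diagonal Ω)ᶜ ∩ {p | M < max (w p.1) (w p.2)}) +
        (1 - (∫⁻ y, ENNReal.ofReal (min 1 (w y)) ∂q) / ENNReal.ofReal (max 1 M)) ^ k * μ₀ (Set.diagonal Ω)ᶜ := by
  set c := ∫⁻ y, ENNReal.ofReal (min 1 (w y)) ∂q with hc
  set T : Set (Ω × Ω) := {p | M < max (w p.1) (w p.2)} with hT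
  have hD : MeasurableSet (Set.diagonal Ω) := measurableSet_diagonal
  have hTm : MeasurableSet T := measurableSet_lt measurable_const ((hw.comp measurable_fst).max (hw.comp measurable_snd))
  set r : ℝ≥0∞ := (1 - c / ENNReal.ofReal (max 1 M)) ^ k with hr
  refine (iterate_bind_crnPair_offDiagonal_le_rate_anyCoupling hw hw0 Khat hK k μ₀).trans ?_
  -- split `Δᶜ` at the level `M`
  have hle : ∀ p ∈ (Set.diagonal Ω)ᶜ, (1 - c / ENNReal.ofReal (max 1 (max (w p.1) (w p.2)))) ^ k ≤
      T.indicator 1 p + r := by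
    intro p _
    by_cases hp : p ∈ T
    · rw [Set.indicator_of_mem hp, Pi.one_apply]
      exact le_add_right ((pow_le_pow_left' tsub_le_self k).trans_eq (one_pow k))
    · rw [Set.indicator_of_notMem hp, zero_add, hr]
      have hpM : max (w p.1) (w p.2) ≤ M := not_lt.1 hp
      exact pow_le_pow_left' (tsub_le_tsub_left (ENNReal.div_le_div_left
        (ENNReal.ofReal_le_ofReal (max_le_max le_rfl hpM)) _) 1) k
  calc ∫⁻ p in (Set.diagonal Ω)ᶜ, (1 - c / ENNReal.ofReal (max 1 (max (w p.1) (w p.2)))) ^ k ∂μ₀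
      ≤ ∫⁻ p in (Set.diagonal Ω)ᶜ, T.indicator 1 p + r ∂μ₀ := setLIntegral_mono' hD.compl hle
    _ = μ₀ ((Set.diagonal Ω)ᶜ ∩ T) + r * μ₀ (Set.diagonal Ω)ᶜ := by
        have h1 : ∫⁻ a in T, (1 : Ω × Ω → ℝ≥0∞) a ∂(μ₀.restrict (Set.diagonal Ω)ᶜ) = μ₀ ((Set.diagonal Ω)ᶜ ∩ T) := by
          rw [Measure.restrict_restrict hTm, Set.inter_comm]; simp only [Pi.one_apply, setLIntegral_one]
        rw [lintegral_add_right _ measurable_const, lintegral_indicator hTm, setLIntegral_const, h1]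

section Replicas

variable {Ω' : Type*} {mΩ' : MeasurableSpace Ω'} {μ : Measure Ω'} [IsProbabilityMeasure μ]
  {Z : ℕ → Ω' → (ℕ → Ω × Ω)}

/-! ## §2 The burn-in Bernstein bar from every initial coupling, every weight -/

omit [IsProbabilityMeasure μ] in
/-- **`P(∃ j < R, Σ_{n<N} D_{k+n}(Z_j) ≠ 0) ≤ R·(ν̂K̂^k)(Δᶜ)`** for EVERY weight (union bound over the replicas; transfer along the law
of each stream). [ours, bookkeeping] -/
theorem crnLag_replicas_some_correction_le_offDiagonal [MeasurableEq Ω] (hw : Measurable w) (hw0 : ∀ y, 0 < w y)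
    (Khat : Kernel (Ω × Ω) (Ω × Ω)) [IsMarkovKernel Khat]
    (hK : ∀ z : Ω × Ω, Khat z = (q.prod (volume : Measure unitInterval)).map (fun p : Ω × unitInterval =>
      ((if (p.2 : ℝ) * w z.1 ≤ w p.1 then p.1 else z.1), (if (p.2 : ℝ) * w z.2 ≤ w p.1 then p.1 else z.2))))
    (ν : Measure (Ω × Ω)) [IsProbabilityMeasure ν] {f : Ω → ℝ} (hf : Measurable f) (k N : ℕ) (hZm : ∀ j, Measurable (Z j))
    (hlaw : ∀ j, μ.map (Z j) = Kernel.trajMeasure (X := fun _ : ℕ => Ω × Ω) ν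
      (fun n : ℕ => Khat.comap (fun h : (i : ↥(Finset.Iic n)) → Ω × Ω => h ⟨n, Finset.mem_Iic.2 le_rfl⟩)
        (measurable_pi_apply _))) (R : ℕ) :
    μ.real (⋃ j ∈ range R, {ω | ∑ n ∈ range N, (f ((Z j ω (k + n)).1) - f ((Z j ω (k + n)).2)) ≠ 0}) ≤
      R * ((fun m : Measure (Ω × Ω) => m.bind Khat)^[k] ν).real (Set.diagonal Ω)ᶜ := by
  have hSm : Measurable fun z : ℕ → Ω × Ω => ∑ n ∈ range N, (f ((z (k + n)).1) - f ((z (k + n)).2)) :=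
    Finset.measurable_sum _ fun n _ =>
      (hf.comp (measurable_fst.comp (measurable_pi_apply (k + n)))).sub (hf.comp (measurable_snd.comp (measurable_pi_apply (k + n))))
  have hE : MeasurableSet {z : ℕ → Ω × Ω | ∑ n ∈ range N, (f ((z (k + n)).1) - f ((z (k + n)).2)) ≠ 0} :=
    hSm (measurableSet_singleton 0).compl
  have hj : ∀ j, μ.real {ω | ∑ n ∈ range N, (f ((Z j ω (k + n)).1) - f ((Z j ω (k + n)).2)) ≠ 0} ≤
      ((fun m : Measure (Ω × Ω) => m.bind Khat)^[k] ν).real (Set.diagonal Ω)ᶜ := fun j => by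
    have heq : μ.real {ω | ∑ n ∈ range N, (f ((Z j ω (k + n)).1) - f ((Z j ω (k + n)).2)) ≠ 0} =
        (μ.map (Z j)).real {z : ℕ → Ω × Ω | ∑ n ∈ range N, (f ((z (k + n)).1) - f ((z (k + n)).2)) ≠ 0} := by
      rw [measureReal_def, measureReal_def, Measure.map_apply (hZm j) hE]; rfl
    rw [heq, hlaw j]
    exact crnLag_correction_ne_zero_le_offDiagonal hw hw0 Khat hK ν f k N
  calc μ.real (⋃ j ∈ range R, {ω | ∑ n ∈ range N, (f ((Z j ω (k + n)).1) - f ((Z j ω (k + n)).2)) ≠ 0})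
      ≤ ∑ j ∈ range R, μ.real {ω | ∑ n ∈ range N, (f ((Z j ω (k + n)).1) - f ((Z j ω (k + n)).2)) ≠ 0} :=
        measureReal_biUnion_finset_le _ _
    _ ≤ ∑ j ∈ range R, ((fun m : Measure (Ω × Ω) => m.bind Khat)^[k] ν).real (Set.diagonal Ω)ᶜ := sum_le_sum fun j _ => hj j
    _ = R * ((fun m : Measure (Ω × Ω) => m.bind Khat)^[k] ν).real (Set.diagonal Ω)ᶜ := by
        rw [sum_const, card_range, nsmul_eq_mul]

/-- **THE BURN-IN BERNSTEIN BAR FOR EVERY WEIGHT, EVERY INITIAL COUPLING**: `R` independent coupled pairs, window `N`, burn-in `k`,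
`σ² ≥ Var_{ν̂₂K^k} f` with `σ² > 0`, `ε ≥ 0`, `R ≥ 1`:
`P(|H̄_R − (ν̂₂K^k) f| ≥ ε) ≤ 2·exp(−Rε²/(2(σ² + (c − a)ε/3))) + R·(ν̂K̂^k)(Δᶜ)`. [ours] -/
theorem crnLag_replicas_burnIn_bernstein_abs_everyWeight [MeasurableEq Ω] [Fact (Measurable w)] (hw0 : ∀ y, 0 < w y)
    [IsProbabilityMeasure (q.withDensity fun y => ENNReal.ofReal (w y))]
    (Khat : Kernel (Ω × Ω) (Ω × Ω)) [IsMarkovKernel Khat]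
    (hK : ∀ z : Ω × Ω, Khat z = (q.prod (volume : Measure unitInterval)).map (fun p : Ω × unitInterval =>
      ((if (p.2 : ℝ) * w z.1 ≤ w p.1 then p.1 else z.1), (if (p.2 : ℝ) * w z.2 ≤ w p.1 then p.1 else z.2))))
    (ν : Measure (Ω × Ω)) [IsProbabilityMeasure ν] {f : Ω → ℝ} (hf : Measurable f) {a c : ℝ} (ha : ∀ x, a ≤ f x)
    (hc : ∀ x, f x ≤ c) (k N : ℕ) (hZm : ∀ j, Measurable (Z j))
    (hlaw : ∀ j, μ.map (Z j) = Kernel.trajMeasure (X := fun _ : ℕ => Ω × Ω) ν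
      (fun n : ℕ => Khat.comap (fun h : (i : ↥(Finset.Iic n)) → Ω × Ω => h ⟨n, Finset.mem_Iic.2 le_rfl⟩)
        (measurable_pi_apply _)))
    (hind : iIndepFun Z μ) {σ2 : ℝ} (hσ : 0 < σ2)
    (hσk : variance f ((fun m : Measure Ω => m.bind (indepMH q w))^[k] (ν.map Prod.snd)) ≤ σ2)
    {ε : ℝ} (hε : 0 ≤ ε) {R : ℕ} (hR : 1 ≤ R) :
    μ.real {ω | ε ≤ |(R : ℝ)⁻¹ * ∑ j ∈ range R, (f ((Z j ω k).2) + ∑ n ∈ range N, (f ((Z j ω (k + n)).1) - f ((Z j ω (k + n)).2))) -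
        ∫ y, f y ∂((fun m : Measure Ω => m.bind (indepMH q w))^[k] (ν.map Prod.snd))|} ≤
      2 * Real.exp (-(R * ε ^ 2) / (2 * (σ2 + (c - a) * ε / 3))) +
        R * ((fun m : Measure (Ω × Ω) => m.bind Khat)^[k] ν).real (Set.diagonal Ω)ᶜ := by
  have hw : Measurable w := Fact.out
  set mk := ∫ y, f y ∂((fun m : Measure Ω => m.bind (indepMH q w))^[k] (ν.map Prod.snd)) with hmk
  set B : Set Ω' := ⋃ j ∈ range R, {ω | ∑ n ∈ range N, (f ((Z j ω (k + n)).1) - f ((Z j ω (k + n)).2)) ≠ 0} with hB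
  have hsub : {ω | ε ≤ |(R : ℝ)⁻¹ * ∑ j ∈ range R, (f ((Z j ω k).2) + ∑ n ∈ range N, (f ((Z j ω (k + n)).1) - f ((Z j ω (k + n)).2))) - mk|}
      ⊆ B ∪ {ω | ε ≤ |(R : ℝ)⁻¹ * ∑ j ∈ range R, f ((Z j ω k).2) - mk|} := by
    intro ω hω
    by_cases hωB : ω ∈ B
    · exact Or.inl hωB
    · right
      have hzero : ∀ j ∈ range R, ∑ n ∈ range N, (f ((Z j ω (k + n)).1) - f ((Z j ω (k + n)).2)) = 0 := by
        intro j hj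
        by_contra hne
        exact hωB (Set.mem_biUnion (show j ∈ (range R : Set ℕ) from by exact_mod_cast hj) hne)
      have hsum : ∑ j ∈ range R, (f ((Z j ω k).2) + ∑ n ∈ range N, (f ((Z j ω (k + n)).1) - f ((Z j ω (k + n)).2))) =
          ∑ j ∈ range R, f ((Z j ω k).2) := sum_congr rfl fun j hj => by rw [hzero j hj, add_zero]
      simp only [Set.mem_setOf_eq] at hω ⊢
      rwa [hsum] at hω
  have h1 := crnLag_replicas_some_correction_le_offDiagonal hw hw0 Khat hK ν hf k N hZm hlaw R
  have h2 := crnLag_replicas_readout_bernstein_abs hw0 Khat hK ν hf ha hc k hZm hlaw hind hσ hσk hε hR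
  calc μ.real {ω | ε ≤ |(R : ℝ)⁻¹ * ∑ j ∈ range R, (f ((Z j ω k).2) + ∑ n ∈ range N, (f ((Z j ω (k + n)).1) - f ((Z j ω (k + n)).2))) - mk|}
      ≤ μ.real (B ∪ {ω | ε ≤ |(R : ℝ)⁻¹ * ∑ j ∈ range R, f ((Z j ω k).2) - mk|}) := measureReal_mono hsub
    _ ≤ μ.real B + μ.real {ω | ε ≤ |(R : ℝ)⁻¹ * ∑ j ∈ range R, f ((Z j ω k).2) - mk|} := measureReal_union_le _ _
    _ ≤ 2 * Real.exp (-(R * ε ^ 2) / (2 * (σ2 + (c - a) * ε / 3))) +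
          R * ((fun m : Measure (Ω × Ω) => m.bind Khat)^[k] ν).real (Set.diagonal Ω)ᶜ := by linarith

end Replicas

/-! ## §3 The practical start: production run at `x`, leading run one update ahead -/

/-- **THE HEAVY PART OF THE PRACTICAL START LIES BELOW THE MODEL**: for `ν̂_x = K(x, ·)∘(y ↦ (y, x))⁻¹` and `w(x) ≤ M`,
`ν̂_x(Δᶜ ∩ {M < max(w(p.1), w(p.2))}) ≤ q{M < w}` (the runs differ at time `0` only when the leading run MOVED, and the moved mass has
density `a(x, ·) ≤ 1` against `q`). [ours] -/
theorem detLag_offDiagonal_tail_le [MeasurableSingletonClass Ω] [MeasurableEq Ω] (hw : Measurable w) (x : Ω) {M : ℝ} (hxM : w x ≤ M)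
    (ν : Measure (Ω × Ω)) (hν : ν = (indepMH q w x).map fun y : Ω => (y, x)) :
    ν ((Set.diagonal Ω)ᶜ ∩ {p | M < max (w p.1) (w p.2)}) ≤ q {y | M < w y} := by
  haveI : Fact (Measurable w) := ⟨hw⟩
  have hφ : Measurable fun y : Ω => (y, x) := measurable_id.prodMk measurable_const
  have hD : MeasurableSet (Set.diagonal Ω) := measurableSet_diagonal
  have hTm : MeasurableSet {p : Ω × Ω | M < max (w p.1) (w p.2)} :=
    measurableSet_lt measurable_const ((hw.comp measurable_fst).max (hw.comp measurable_snd))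
  have hSm : MeasurableSet {y : Ω | M < w y} := measurableSet_lt measurable_const hw
  have hpre : (fun y : Ω => (y, x)) ⁻¹' ((Set.diagonal Ω)ᶜ ∩ {p | M < max (w p.1) (w p.2)}) = ({x}ᶜ : Set Ω) ∩ {y | M < w y} := by
    ext y
    simp only [Set.preimage_inter, Set.mem_inter_iff, Set.mem_preimage, Set.mem_compl_iff, Set.mem_diagonal_iff,
      Set.mem_setOf_eq, Set.mem_singleton_iff]
    constructor
    · rintro ⟨hne, hlt⟩
      refine ⟨hne, ?_⟩
      rcases lt_max_iff.1 hlt with h | h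
      · exact h
      · exact absurd (h.trans_le hxM) (lt_irrefl _)
    · rintro ⟨hne, hlt⟩
      exact ⟨hne, lt_max_iff.2 (Or.inl hlt)⟩
  calc ν ((Set.diagonal Ω)ᶜ ∩ {p | M < max (w p.1) (w p.2)})
      = (indepMH q w x) (({x}ᶜ : Set Ω) ∩ {y | M < w y}) := by rw [hν, Measure.map_apply hφ (hD.compl.inter hTm), hpre]
    _ = ∫⁻ y in {x}ᶜ, {y | M < w y}.indicator 1 y ∂(indepMH q w x) := by
        rw [lintegral_indicator_one hSm, Measure.restrict_apply hSm, Set.inter_comm]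
    _ ≤ ∫⁻ y, {y | M < w y}.indicator 1 y ∂q := setLIntegral_compl_singleton_indepMH_le hw x (measurable_one.indicator hSm)
    _ = q {y | M < w y} := lintegral_indicator_one hSm

/-- **THE DISAGREEMENT PROBABILITY FROM THE PRACTICAL START, EVERY WEIGHT**: standard Borel `Ω`; for `ν̂_x = K(x, ·)∘(y ↦ (y, x))⁻¹`,
`w(x) ≤ M` and every `k`, `P(X_k ≠ X′_k) = (ν̂_xK̂^k)(Δᶜ) ≤ q{M < w} + (1 − c₁/max(1, M))^k`, `c₁ = E_q[min(1, w)]` (`ℝ≥0∞`). [ours] -/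
theorem iterate_bind_crnPair_offDiagonal_detLag_le_tail [StandardBorelSpace Ω] [Nonempty Ω] [MeasurableSingletonClass Ω]
    [MeasurableEq Ω] (hw : Measurable w) (hw0 : ∀ y, 0 < w y) (Khat : Kernel (Ω × Ω) (Ω × Ω)) [IsMarkovKernel Khat]
    (hK : ∀ z : Ω × Ω, Khat z = (q.prod (volume : Measure unitInterval)).map (fun p : Ω × unitInterval =>
      ((if (p.2 : ℝ) * w z.1 ≤ w p.1 then p.1 else z.1), (if (p.2 : ℝ) * w z.2 ≤ w p.1 then p.1 else z.2))))
    (x : Ω) {M : ℝ} (hxM : w x ≤ M) (ν : Measure (Ω × Ω)) [IsProbabilityMeasure ν]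
    (hν : ν = (indepMH q w x).map fun y : Ω => (y, x)) (k : ℕ) :
    ((fun m : Measure (Ω × Ω) => m.bind Khat)^[k] ν) (Set.diagonal Ω)ᶜ ≤
      q {y | M < w y} + (1 - (∫⁻ y, ENNReal.ofReal (min 1 (w y)) ∂q) / ENNReal.ofReal (max 1 M)) ^ k := by
  refine (iterate_bind_crnPair_offDiagonal_le_tail_anyCoupling hw hw0 Khat hK k ν M).trans ?_
  exact add_le_add (detLag_offDiagonal_tail_le hw x hxM ν hν) (mul_le_of_le_one_right' prob_le_one)

section Replicas

variable {Ω' : Type*} {mΩ' : MeasurableSpace Ω'} {μ : Measure Ω'} [IsProbabilityMeasure μ]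
  {Z : ℕ → Ω' → (ℕ → Ω × Ω)}

/-- **THE BERNSTEIN BAR ABOUT `π f` FROM THE PRACTICAL START — EVERY WEIGHT, EVERY PROPOSAL LAW**: standard Borel `Ω`; production run
at `x` with `w(x) ≤ M`, leading run one update ahead (`ν̂_x = K(x, ·)∘(y ↦ (y, x))⁻¹`), `R` independent coupled pairs, window `N`,
burn-in `k`, `σ² ≥ Var_{δ_xK^k} f` with `σ² > 0`, `ε ≥ 0`, `R ≥ 1`:
`P(|H̄_R − π f| ≥ ε + (c − a)(π{M < w} + (1 − c₁/max(1, M))^k)) ≤ 2·exp(−Rε²/(2(σ² + (c − a)ε/3))) + R·(q{M < w} + (1 − c₁/max(1, M))^k)`. [ours] -/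
theorem crnLag_replicas_burnIn_bernstein_abs_target_everyWeight [StandardBorelSpace Ω] [Nonempty Ω] [MeasurableSingletonClass Ω]
    [MeasurableEq Ω] [Fact (Measurable w)] (hw0 : ∀ y, 0 < w y) [IsProbabilityMeasure (q.withDensity fun y => ENNReal.ofReal (w y))]
    (Khat : Kernel (Ω × Ω) (Ω × Ω)) [IsMarkovKernel Khat]
    (hK : ∀ z : Ω × Ω, Khat z = (q.prod (volume : Measure unitInterval)).map (fun p : Ω × unitInterval =>
      ((if (p.2 : ℝ) * w z.1 ≤ w p.1 then p.1 else z.1), (if (p.2 : ℝ) * w z.2 ≤ w p.1 then p.1 else z.2))))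
    (x : Ω) {M : ℝ} (hxM : w x ≤ M) (ν : Measure (Ω × Ω)) [IsProbabilityMeasure ν]
    (hν : ν = (indepMH q w x).map fun y : Ω => (y, x)) {f : Ω → ℝ} (hf : Measurable f) {a c : ℝ} (ha : ∀ y, a ≤ f y)
    (hc : ∀ y, f y ≤ c) (k N : ℕ) (hZm : ∀ j, Measurable (Z j))
    (hlaw : ∀ j, μ.map (Z j) = Kernel.trajMeasure (X := fun _ : ℕ => Ω × Ω) ν
      (fun n : ℕ => Khat.comap (fun h : (i : ↥(Finset.Iic n)) → Ω × Ω => h ⟨n, Finset.mem_Iic.2 le_rfl⟩)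
        (measurable_pi_apply _)))
    (hind : iIndepFun Z μ) {σ2 : ℝ} (hσ : 0 < σ2)
    (hσk : variance f ((fun m : Measure Ω => m.bind (indepMH q w))^[k] (Measure.dirac x)) ≤ σ2)
    {ε : ℝ} (hε : 0 ≤ ε) {R : ℕ} (hR : 1 ≤ R) :
    μ.real {ω | ε + (c - a) * ((q.withDensity fun y => ENNReal.ofReal (w y)) {y | M < w y} +
          (1 - (∫⁻ y, ENNReal.ofReal (min 1 (w y)) ∂q) / ENNReal.ofReal (max 1 M)) ^ k).toReal ≤
        |(R : ℝ)⁻¹ * ∑ j ∈ range R, (f ((Z j ω k).2) + ∑ n ∈ range N, (f ((Z j ω (k + n)).1) - f ((Z j ω (k + n)).2))) -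
          ∫ y, f y ∂(q.withDensity fun y => ENNReal.ofReal (w y))|} ≤
      2 * Real.exp (-(R * ε ^ 2) / (2 * (σ2 + (c - a) * ε / 3))) +
        R * (q {y | M < w y} + (1 - (∫⁻ y, ENNReal.ofReal (min 1 (w y)) ∂q) / ENNReal.ofReal (max 1 M)) ^ k).toReal := by
  have hw : Measurable w := Fact.out
  have hφ : Measurable fun y : Ω => (y, x) := measurable_id.prodMk measurable_const
  set c₁ := ∫⁻ y, ENNReal.ofReal (min 1 (w y)) ∂q with hc₁
  set r : ℝ≥0∞ := (1 - c₁ / ENNReal.ofReal (max 1 M)) ^ k with hr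
  have hr1 : r ≤ 1 := (pow_le_pow_left' tsub_le_self k).trans_eq (one_pow k)
  -- the lower marginal of the practical start is the point mass at `x`
  have hsnd : ν.map Prod.snd = Measure.dirac x := by
    rw [hν, Measure.map_map measurable_snd hφ]
    have : (Prod.snd ∘ fun y : Ω => (y, x)) = fun _ => x := rfl
    rw [this, Measure.map_const, measure_univ, one_smul]
  set πm : Measure Ω := q.withDensity fun y => ENNReal.ofReal (w y) with hπm
  set mk := ∫ y, f y ∂((fun m : Measure Ω => m.bind (indepMH q w))^[k] (Measure.dirac x)) with hmk
  set πf := ∫ y, f y ∂πm with hπf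
  set X : ℕ → Ω' → ℝ := fun j ω => f ((Z j ω k).2) + ∑ n ∈ range N, (f ((Z j ω (k + n)).1) - f ((Z j ω (k + n)).2)) with hX
  -- the every-weight Bernstein bar about `mk`
  have hσk' : variance f ((fun m : Measure Ω => m.bind (indepMH q w))^[k] (ν.map Prod.snd)) ≤ σ2 := by rw [hsnd]; exact hσk
  have h := crnLag_replicas_burnIn_bernstein_abs_everyWeight hw0 Khat hK ν hf ha hc k N hZm hlaw hind hσ hσk' hε hR
  rw [hsnd] at h
  -- the disagreement probability at time `k` from the practical start
  have hoff : ((fun m : Measure (Ω × Ω) => m.bind Khat)^[k] ν).real (Set.diagonal Ω)ᶜ ≤ (q {y | M < w y} + r).toReal := by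
    rw [measureReal_def]
    exact ENNReal.toReal_mono (ENNReal.add_ne_top.2 ⟨measure_ne_top q _, ne_top_of_le_ne_top ENNReal.one_ne_top hr1⟩)
      (iterate_bind_crnPair_offDiagonal_detLag_le_tail hw hw0 Khat hK x hxM ν hν k)
  -- the bias allowance: GEN-40's every-start observable rate, at level `M ≥ w(x)`
  have hbias : |mk - πf| ≤ (c - a) * (πm {y | M < w y} + r).toReal := by
    have hb := imh_everyStart_integral_sub_abs_le_tail (q := q) hw hw0 x hf ha hc k M
    rw [max_eq_right hxM, abs_sub_comm] at hb
    exact hb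
  have hsub : {ω | ε + (c - a) * (πm {y | M < w y} + r).toReal ≤ |(R : ℝ)⁻¹ * ∑ j ∈ range R, X j ω - πf|} ⊆
      {ω | ε ≤ |(R : ℝ)⁻¹ * ∑ j ∈ range R, X j ω - mk|} := by
    intro ω hω
    simp only [Set.mem_setOf_eq] at hω ⊢
    have htri : |(R : ℝ)⁻¹ * ∑ j ∈ range R, X j ω - πf| ≤ |(R : ℝ)⁻¹ * ∑ j ∈ range R, X j ω - mk| + |mk - πf| :=
      abs_sub_le ((R : ℝ)⁻¹ * ∑ j ∈ range R, X j ω) mk πf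
    linarith
  have hRnn : (0 : ℝ) ≤ R := Nat.cast_nonneg R
  calc μ.real {ω | ε + (c - a) * (πm {y | M < w y} + r).toReal ≤ |(R : ℝ)⁻¹ * ∑ j ∈ range R, X j ω - πf|}
      ≤ μ.real {ω | ε ≤ |(R : ℝ)⁻¹ * ∑ j ∈ range R, X j ω - mk|} := measureReal_mono hsub
    _ ≤ 2 * Real.exp (-(R * ε ^ 2) / (2 * (σ2 + (c - a) * ε / 3))) +
          R * ((fun m : Measure (Ω × Ω) => m.bind Khat)^[k] ν).real (Set.diagonal Ω)ᶜ := h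
    _ ≤ 2 * Real.exp (-(R * ε ^ 2) / (2 * (σ2 + (c - a) * ε / 3))) + R * (q {y | M < w y} + r).toReal := by
        gcongr

/-! ## §4 The recipe (numbers) -/

/-- **THE BERNSTEIN RECIPE WITHOUT A WEIGHT BOUND.**  In the setting of `crnLag_replicas_burnIn_bernstein_abs_target_everyWeight` (`w(x) ≤ M`,
`ρ = 1 − c₁/max(1, M)`): if the bias allowance is spent, `(c − a)(π{M < w} + ρ^k) ≤ ε`, the replicas pay the Bernstein price,
`2(σ² + (c − a)ε/3)·log(4/δ) ≤ Rε²`, and the burn-in pays the coupling price, `R·(q{M < w} + ρ^k) ≤ δ/2`, then for every window `N`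
`P(|H̄_R − π f| ≥ 2ε) ≤ δ` — `R = ⌈2(σ² + (c − a)ε/3)·log(4/δ)/ε²⌉` pairs; the two tail numbers are read off the proposal stream and the target's
weight tail at the declared level `M`. [ours] -/
theorem crnLag_replicas_bernstein_budget_everyWeight [StandardBorelSpace Ω] [Nonempty Ω] [MeasurableSingletonClass Ω]
    [MeasurableEq Ω] [Fact (Measurable w)] (hw0 : ∀ y, 0 < w y) [IsProbabilityMeasure (q.withDensity fun y => ENNReal.ofReal (w y))]
    (Khat : Kernel (Ω × Ω) (Ω × Ω)) [IsMarkovKernel Khat]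
    (hK : ∀ z : Ω × Ω, Khat z = (q.prod (volume : Measure unitInterval)).map (fun p : Ω × unitInterval =>
      ((if (p.2 : ℝ) * w z.1 ≤ w p.1 then p.1 else z.1), (if (p.2 : ℝ) * w z.2 ≤ w p.1 then p.1 else z.2))))
    (x : Ω) {M : ℝ} (hxM : w x ≤ M) (ν : Measure (Ω × Ω)) [IsProbabilityMeasure ν]
    (hν : ν = (indepMH q w x).map fun y : Ω => (y, x)) {f : Ω → ℝ} (hf : Measurable f) {a c : ℝ} (ha : ∀ y, a ≤ f y)
    (hc : ∀ y, f y ≤ c) (k N : ℕ) (hZm : ∀ j, Measurable (Z j))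
    (hlaw : ∀ j, μ.map (Z j) = Kernel.trajMeasure (X := fun _ : ℕ => Ω × Ω) ν
      (fun n : ℕ => Khat.comap (fun h : (i : ↥(Finset.Iic n)) → Ω × Ω => h ⟨n, Finset.mem_Iic.2 le_rfl⟩)
        (measurable_pi_apply _)))
    (hind : iIndepFun Z μ) {σ2 : ℝ} (hσ : 0 < σ2)
    (hσk : variance f ((fun m : Measure Ω => m.bind (indepMH q w))^[k] (Measure.dirac x)) ≤ σ2)
    {ε δ : ℝ} (hε : 0 ≤ ε) (hδ : 0 < δ) {R : ℕ} (hR : 1 ≤ R)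
    (hbias : (c - a) * ((q.withDensity fun y => ENNReal.ofReal (w y)) {y | M < w y} +
        (1 - (∫⁻ y, ENNReal.ofReal (min 1 (w y)) ∂q) / ENNReal.ofReal (max 1 M)) ^ k).toReal ≤ ε)
    (hRε : 2 * (σ2 + (c - a) * ε / 3) * Real.log (4 / δ) ≤ R * ε ^ 2)
    (hcoup : R * (q {y | M < w y} + (1 - (∫⁻ y, ENNReal.ofReal (min 1 (w y)) ∂q) / ENNReal.ofReal (max 1 M)) ^ k).toReal ≤ δ / 2) :
    μ.real {ω | 2 * ε ≤
        |(R : ℝ)⁻¹ * ∑ j ∈ range R, (f ((Z j ω k).2) + ∑ n ∈ range N, (f ((Z j ω (k + n)).1) - f ((Z j ω (k + n)).2))) -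
          ∫ y, f y ∂(q.withDensity fun y => ENNReal.ofReal (w y))|} ≤ δ := by
  have hca : 0 ≤ c - a := by linarith [ha x, hc x]
  have hexp : 2 * Real.exp (-(R * ε ^ 2) / (2 * (σ2 + (c - a) * ε / 3))) ≤ δ / 2 :=
    two_mul_exp_bernstein_le_of_log_le (by positivity) hδ hRε
  have h := crnLag_replicas_burnIn_bernstein_abs_target_everyWeight hw0 Khat hK x hxM ν hν hf ha hc k N hZm hlaw hind hσ hσk hε hR
  refine le_trans (le_trans (measureReal_mono fun ω hω => ?_) h) (by linarith)
  simp only [Set.mem_setOf_eq] at hω ⊢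
  linarith

end Replicas

end Summit.Ventures.LatticeQCDFlow.Exactness

end
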